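import Mathlib
import HarnessLib
import Literature.MathematicalPhysics.QuantumLattice.KohnLuttingerRadialProjection
import Summits.HubbardSuperconductivity.HubbardSuperconductivity.Theses.ChiralWindow
import Summits.HubbardSuperconductivity.HubbardSuperconductivity.Theorems.ChiralWindowCwChannelInfContinuousL2

/-!
# Route `ChiralWindow`, support `CwChannelInfContinuous` (item `stmt-HubbardSuperconductivity-1744`):
transport of channel states between nearby chemical potentials

The variational half of the `μ`-continuity of `μ ↦ channelInf ε μ U χ` (`ε = squareDispersion 1 0`,
`-4 < μ < 0`). Every channel state `ψ` at level `μ` is moved to level `μ'` by the **radial transport**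
`ψ̃(k) = ψ(fermiPolar μ (arg k))` (`ψ̃(0) = 0`), which keeps the symmetry channel
(`Literature…inChannel_radialTransport`) and has the SAME angular profile `Ψ = ψ ∘ γ_μ = ψ̃ ∘ γ_μ'`;
in the polar picture (`Literature…pairingForm_eq_polar`) the pairing forms at the two levels are
then the quadratic forms of `Ψ` with the kernels
`M_μ(θ,θ') = w_μ(θ) Γ_μ(γ_μθ, γ_μθ') w_μ(θ')`, and the Hilbert–Schmidt bound of
`ChiralWindowCwChannelInfContinuousL2` controls the difference. Main result:

* `channelInf_le_channelInf_add` — **one-sided comparison**: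
  `channelInf ε μ' U χ ≤ channelInf ε μ U χ + 2‖M_μ' - M_μ‖₂/w₀ + 2(‖M_μ‖₂/w₀)(η/w₀)`
  whenever `w_μ ≥ w₀ > 0`, `|w_μ' - w_μ| ≤ η ≤ w₀/2` and both kernels are in `L²(dθ dθ')`;
  also `pairingForm_bddBelow_image` (the `sInf` is over a bounded-below, non-empty set).

No definitions. [folklore]
-/

noncomputable section

open MeasureTheory Real Set Filter
open scoped ENNReal Classical

-- the tree's namespace `Summit.<Summit>.<Problem>.Theorems` repeats the summit name by design (D-0017)
set_option linter.dupNamespace false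

namespace Summit.HubbardSuperconductivity.HubbardSuperconductivity.Theorems

open Literature.MathematicalPhysics.QuantumLattice

/-- The Kohn–Luttinger kernel of the square lattice in polar coordinates, written out:
`M_μ(θ, θ') = w_μ(θ) Γ_μ(γ_μ θ, γ_μ θ') w_μ(θ')` (local notation only). -/
local notation "Mker[" μ ", " U "]" => (fun z : ℝ × ℝ =>
  fermiPolarDOS μ (Prod.fst z) * kohnLuttingerKernel (squareDispersion 1 0) μ U (fermiPolar μ (Prod.fst z))
    (fermiPolar μ (Prod.snd z)) * fermiPolarDOS μ (Prod.snd z))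

/-- The parameter interval `(-π, π]` with Lebesgue measure (local notation only). -/
local notation "λθ" => (volume.restrict (Set.Ioc (-π) π) : Measure ℝ)

section Transport

variable {μ μ' : ℝ} (hμ₁ : -4 < μ) (hμ₂ : μ < 0) (hμ₁' : -4 < μ') (hμ₂' : μ' < 0)
include hμ₁ hμ₂

/-! ### Channel states in the angular picture -/

/-- The angular profile `Ψ = ψ ∘ γ_μ` of an `L²(μ_F)` function is in `L²(dθ ⌞ (-π,π])`, with
`∫ Ψ² ≤ w₀⁻¹ ∫ w_μ Ψ² = w₀⁻¹ ∫ ψ² dμ_F` when `w_μ ≥ w₀ > 0`. [folklore] -/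
theorem memLp_profile {ψ : Momentum → ℝ} (hmem : MemLp ψ 2 (fermiCurveMeasure (squareDispersion 1 0) μ))
    {w₀ : ℝ} (hw₀ : 0 < w₀) (hw : ∀ θ, w₀ ≤ fermiPolarDOS μ θ) :
    MemLp (fun θ => ψ (fermiPolar μ θ)) 2 λθ ∧
      ∫ θ in Set.Ioc (-π) π, ψ (fermiPolar μ θ) ^ 2 ≤
        w₀⁻¹ * ∫ k, ψ k ^ 2 ∂fermiCurveMeasure (squareDispersion 1 0) μ := by
  have hΨm : AEStronglyMeasurable (fun θ => ψ (fermiPolar μ θ)) λθ :=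
    aestronglyMeasurable_comp_fermiPolar hμ₁ hμ₂ hmem.1
  have hsq : Integrable (fun k => ψ k ^ 2) (fermiCurveMeasure (squareDispersion 1 0) μ) :=
    (memLp_two_iff_integrable_sq hmem.1).1 hmem
  have hwΨ : Integrable (fun θ => fermiPolarDOS μ θ * ψ (fermiPolar μ θ) ^ 2) λθ :=
    (integrable_fermiCurveMeasure_iff hμ₁ hμ₂ (hmem.1.pow 2)).1 hsq
  have hdom : Integrable (fun θ => ψ (fermiPolar μ θ) ^ 2) λθ := by
    refine (hwΨ.const_mul w₀⁻¹).mono (hΨm.pow 2) (Eventually.of_forall fun θ => ?_)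
    rw [Real.norm_eq_abs, Real.norm_eq_abs, abs_of_nonneg (sq_nonneg _),
      abs_of_nonneg (mul_nonneg (inv_nonneg.2 hw₀.le) (mul_nonneg (fermiPolarDOS_pos hμ₁ hμ₂ θ).le (sq_nonneg _)))]
    have := hw θ
    calc ψ (fermiPolar μ θ) ^ 2 = w₀⁻¹ * (w₀ * ψ (fermiPolar μ θ) ^ 2) := by field_simp
      _ ≤ w₀⁻¹ * (fermiPolarDOS μ θ * ψ (fermiPolar μ θ) ^ 2) := by gcongr
  refine ⟨(memLp_two_iff_integrable_sq hΨm).2 hdom, ?_⟩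
  rw [integral_sq_fermiCurveMeasure hμ₁ hμ₂ hmem.1, ← integral_const_mul]
  refine integral_mono hdom (hwΨ.const_mul _) fun θ => ?_
  have := hw θ
  calc ψ (fermiPolar μ θ) ^ 2 = w₀⁻¹ * (w₀ * ψ (fermiPolar μ θ) ^ 2) := by field_simp
    _ ≤ w₀⁻¹ * (fermiPolarDOS μ θ * ψ (fermiPolar μ θ) ^ 2) := by gcongr

/-- **The pairing form is bounded on channel states** by the Hilbert–Schmidt norm of the polar
kernel: `|⟨ψ, Γψ⟩| ≤ w₀⁻¹ ‖M_μ‖₂` for every channel state `ψ`. [folklore] -/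
theorem abs_pairingForm_le (U : ℝ) {χ : D4Irrep} {ψ : Momentum → ℝ}
    (hψ : IsChannelState (squareDispersion 1 0) μ χ ψ) {w₀ : ℝ} (hw₀ : 0 < w₀)
    (hw : ∀ θ, w₀ ≤ fermiPolarDOS μ θ) (hM : MemLp Mker[μ, U] 2 ((λθ).prod λθ)) :
    |pairingForm (squareDispersion 1 0) μ U ψ| ≤
      w₀⁻¹ * Real.sqrt (∫ z, Mker[μ, U] z ^ 2 ∂((λθ).prod λθ)) := by
  obtain ⟨hmem, hnorm, -⟩ := hψ
  obtain ⟨hΨ, hΨle⟩ := memLp_profile hμ₁ hμ₂ hmem hw₀ hw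
  rw [hnorm, mul_one] at hΨle
  rw [pairingForm_eq_polar hμ₁ hμ₂ U hmem.1]
  have h := abs_integral_mul_integral_mul_le hΨ hM
  refine h.trans ?_
  exact mul_le_mul_of_nonneg_right hΨle (Real.sqrt_nonneg _)

/-- The image of the channel-state set under the pairing form is bounded below. [folklore] -/
theorem pairingForm_bddBelow_image (U : ℝ) (χ : D4Irrep) {w₀ : ℝ} (hw₀ : 0 < w₀)
    (hw : ∀ θ, w₀ ≤ fermiPolarDOS μ θ) (hM : MemLp Mker[μ, U] 2 ((λθ).prod λθ)) :
    BddBelow ((pairingForm (squareDispersion 1 0) μ U) '' {ψ | IsChannelState (squareDispersion 1 0) μ χ ψ}) := by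
  refine ⟨-(w₀⁻¹ * Real.sqrt (∫ z, Mker[μ, U] z ^ 2 ∂((λθ).prod λθ))), ?_⟩
  rintro _ ⟨ψ, hψ, rfl⟩
  have h := abs_pairingForm_le hμ₁ hμ₂ U hψ hw₀ hw hM
  exact neg_le_of_abs_le h

/-! ### The radial transport -/

include hμ₁' hμ₂'

/-- The transported gap function restricted to the level-`μ'` curve has the level-`μ` profile:
`ψ̃(γ_μ' θ) = ψ(γ_μ θ)`. [folklore] -/
theorem transport_fermiPolar (ψ : Momentum → ℝ) (θ : ℝ) :
    (if fermiPolar μ' θ = 0 then 0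
      else ψ (fermiPolar μ (Complex.arg ⟨fermiPolar μ' θ 0, fermiPolar μ' θ 1⟩))) = ψ (fermiPolar μ θ) := by
  rw [if_neg (fermiPolar_ne_zero hμ₁' hμ₂' θ), fermiPolar_arg_fermiPolar hμ₁ hμ₂ hμ₁' hμ₂' θ]

/-- **The radial projection pushes `μ_F(μ')` forward to a measure absolutely continuous with
respect to `μ_F(μ)`.** [folklore] -/
theorem map_radial_absolutelyContinuous :
    Measure.map (fun k : Momentum => fermiPolar μ (Complex.arg ⟨k 0, k 1⟩))
        (fermiCurveMeasure (squareDispersion 1 0) μ') ≪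
      fermiCurveMeasure (squareDispersion 1 0) μ := by
  have hP := measurable_fermiPolar_arg hμ₁ hμ₂
  have hγ' : Measurable (fermiPolar μ') := (continuous_fermiPolar hμ₁' hμ₂').measurable
  have hγ : Measurable (fermiPolar μ) := (continuous_fermiPolar hμ₁ hμ₂).measurable
  rw [fermiCurveMeasure_eq_map hμ₁' hμ₂', fermiCurveMeasure_eq_map hμ₁ hμ₂, Measure.map_map hP hγ']
  have hcomp : (fun k : Momentum => fermiPolar μ (Complex.arg ⟨k 0, k 1⟩)) ∘ fermiPolar μ' = fermiPolar μ :=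
    funext fun θ => fermiPolar_arg_fermiPolar hμ₁ hμ₂ hμ₁' hμ₂' θ
  rw [hcomp]
  refine Measure.AbsolutelyContinuous.map ?_ hγ
  -- `w' dθ ≪ dθ ≪ w dθ` on `(-π, π]`
  refine (withDensity_absolutelyContinuous _ _).trans ?_
  refine withDensity_absolutelyContinuous' ?_ ?_
  · exact (ENNReal.measurable_ofReal.comp (continuous_fermiPolarDOS hμ₁ hμ₂).measurable).aemeasurable
  · exact Eventually.of_forall fun θ => (ENNReal.ofReal_pos.2 (fermiPolarDOS_pos hμ₁ hμ₂ θ)).ne'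

/-- **The transported function is a.e.-strongly measurable for `μ_F(μ')`.** [folklore] -/
theorem aestronglyMeasurable_transport {ψ : Momentum → ℝ}
    (hψ : AEStronglyMeasurable ψ (fermiCurveMeasure (squareDispersion 1 0) μ)) :
    AEStronglyMeasurable (fun k : Momentum => if k = 0 then 0 else ψ (fermiPolar μ (Complex.arg ⟨k 0, k 1⟩)))
      (fermiCurveMeasure (squareDispersion 1 0) μ') := by
  have h1 : AEStronglyMeasurable (fun k : Momentum => ψ (fermiPolar μ (Complex.arg ⟨k 0, k 1⟩)))
      (fermiCurveMeasure (squareDispersion 1 0) μ') :=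
    (hψ.mono_ac (map_radial_absolutelyContinuous hμ₁ hμ₂ hμ₁' hμ₂')).comp_measurable
      (measurable_fermiPolar_arg hμ₁ hμ₂)
  have heq : (fun k : Momentum => if k = 0 then 0 else ψ (fermiPolar μ (Complex.arg ⟨k 0, k 1⟩))) =
      Set.indicator {k : Momentum | k ≠ 0} fun k => ψ (fermiPolar μ (Complex.arg ⟨k 0, k 1⟩)) := by
    funext k
    by_cases hk : k = 0 <;> simp [hk]
  rw [heq]
  exact h1.indicator (isClosed_singleton.isOpen_compl.measurableSet)

/-- `∫ ψ̃² dμ_F(μ') = ∫ w_μ' Ψ²`. [folklore] -/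
theorem integral_sq_transport {ψ : Momentum → ℝ}
    (hψ : AEStronglyMeasurable ψ (fermiCurveMeasure (squareDispersion 1 0) μ)) :
    ∫ k, (fun k : Momentum => if k = 0 then 0 else ψ (fermiPolar μ (Complex.arg ⟨k 0, k 1⟩))) k ^ 2
        ∂fermiCurveMeasure (squareDispersion 1 0) μ' =
      ∫ θ in Set.Ioc (-π) π, fermiPolarDOS μ' θ * ψ (fermiPolar μ θ) ^ 2 := by
  rw [integral_sq_fermiCurveMeasure hμ₁' hμ₂' (aestronglyMeasurable_transport hμ₁ hμ₂ hμ₁' hμ₂' hψ)]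
  refine setIntegral_congr_fun measurableSet_Ioc fun θ _ => ?_
  rw [transport_fermiPolar hμ₁ hμ₂ hμ₁' hμ₂']

/-- `⟨ψ̃, Γ_μ' ψ̃⟩ = ∫ Ψ (∫ M_μ' Ψ)`. [folklore] -/
theorem pairingForm_transport (U : ℝ) {ψ : Momentum → ℝ}
    (hψ : AEStronglyMeasurable ψ (fermiCurveMeasure (squareDispersion 1 0) μ)) :
    pairingForm (squareDispersion 1 0) μ' U
        (fun k : Momentum => if k = 0 then 0 else ψ (fermiPolar μ (Complex.arg ⟨k 0, k 1⟩))) =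
      ∫ θ in Set.Ioc (-π) π, ψ (fermiPolar μ θ) * ∫ θ' in Set.Ioc (-π) π,
        (fermiPolarDOS μ' θ * kohnLuttingerKernel (squareDispersion 1 0) μ' U (fermiPolar μ' θ) (fermiPolar μ' θ') *
          fermiPolarDOS μ' θ') * ψ (fermiPolar μ θ') := by
  rw [pairingForm_eq_polar hμ₁' hμ₂' U (aestronglyMeasurable_transport hμ₁ hμ₂ hμ₁' hμ₂' hψ)]
  refine setIntegral_congr_fun measurableSet_Ioc fun θ _ => ?_
  rw [transport_fermiPolar hμ₁ hμ₂ hμ₁' hμ₂']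
  congr 1
  refine setIntegral_congr_fun measurableSet_Ioc fun θ' _ => ?_
  rw [transport_fermiPolar hμ₁ hμ₂ hμ₁' hμ₂']

/-- **The transported function is in `L²(μ_F(μ'))`** (the densities of states at the two levels are
comparable: `w_μ' ≤ w_μ + η ≤ (1 + η/w₀) w_μ`). [folklore] -/
theorem memLp_transport {ψ : Momentum → ℝ} (hmem : MemLp ψ 2 (fermiCurveMeasure (squareDispersion 1 0) μ))
    {w₀ η : ℝ} (hw₀ : 0 < w₀) (hw : ∀ θ, w₀ ≤ fermiPolarDOS μ θ) (hη0 : 0 ≤ η)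
    (hη : ∀ θ, |fermiPolarDOS μ' θ - fermiPolarDOS μ θ| ≤ η) :
    MemLp (fun k : Momentum => if k = 0 then 0 else ψ (fermiPolar μ (Complex.arg ⟨k 0, k 1⟩))) 2
      (fermiCurveMeasure (squareDispersion 1 0) μ') := by
  have hT := aestronglyMeasurable_transport hμ₁ hμ₂ hμ₁' hμ₂' hmem.1
  have hT2 : AEStronglyMeasurable (fun k : Momentum =>
      (if k = 0 then 0 else ψ (fermiPolar μ (Complex.arg ⟨k 0, k 1⟩))) ^ 2)
      (fermiCurveMeasure (squareDispersion 1 0) μ') := hT.pow 2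
  rw [memLp_two_iff_integrable_sq hT]
  refine (integrable_fermiCurveMeasure_iff hμ₁' hμ₂' hT2).2 ?_
  have hsq : Integrable (fun k => ψ k ^ 2) (fermiCurveMeasure (squareDispersion 1 0) μ) :=
    (memLp_two_iff_integrable_sq hmem.1).1 hmem
  have hwΨ : Integrable (fun θ => fermiPolarDOS μ θ * ψ (fermiPolar μ θ) ^ 2) λθ :=
    (integrable_fermiCurveMeasure_iff hμ₁ hμ₂ (hmem.1.pow 2)).1 hsq
  have hΨm : AEStronglyMeasurable (fun θ => ψ (fermiPolar μ θ)) λθ :=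
    aestronglyMeasurable_comp_fermiPolar hμ₁ hμ₂ hmem.1
  have heq : (fun θ => fermiPolarDOS μ' θ *
      (if fermiPolar μ' θ = 0 then 0
        else ψ (fermiPolar μ (Complex.arg ⟨fermiPolar μ' θ 0, fermiPolar μ' θ 1⟩))) ^ 2) =
      fun θ => fermiPolarDOS μ' θ * ψ (fermiPolar μ θ) ^ 2 := by
    funext θ; rw [transport_fermiPolar hμ₁ hμ₂ hμ₁' hμ₂']
  rw [heq]
  refine (hwΨ.const_mul (1 + η / w₀)).mono
    ((continuous_fermiPolarDOS hμ₁' hμ₂').aestronglyMeasurable.mul (hΨm.pow 2))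
    (Eventually.of_forall fun θ => ?_)
  have hwθ := hw θ
  have hw'le : fermiPolarDOS μ' θ ≤ (1 + η / w₀) * fermiPolarDOS μ θ := by
    have h1 : fermiPolarDOS μ' θ ≤ fermiPolarDOS μ θ + η := by
      have := (abs_le.1 (hη θ)).2; linarith
    have h2 : η ≤ η / w₀ * fermiPolarDOS μ θ := by
      rw [div_mul_eq_mul_div, le_div_iff₀ hw₀]
      exact mul_le_mul_of_nonneg_left hwθ hη0
    linarith
  rw [Real.norm_eq_abs, Real.norm_eq_abs, abs_of_nonneg (mul_nonneg (fermiPolarDOS_pos hμ₁' hμ₂' θ).le (sq_nonneg _)),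
    abs_of_nonneg (mul_nonneg (by positivity) (mul_nonneg (fermiPolarDOS_pos hμ₁ hμ₂ θ).le (sq_nonneg _))),
    ← mul_assoc]
  exact mul_le_mul_of_nonneg_right hw'le (sq_nonneg _)

/-! ### The one-sided comparison of channel bottoms -/

/-- **One-sided comparison of channel bottoms under a change of chemical potential.**
Let `-4 < μ, μ' < 0`, `w_μ ≥ w₀ > 0`, `|w_μ' - w_μ| ≤ η` with `2η ≤ w₀`, and let the polar kernels
`M_μ, M_μ'` lie in `L²(dθ dθ' ⌞ (-π,π]²)`. Then
`channelInf ε μ' U χ ≤ channelInf ε μ U χ + 2 ‖M_μ' - M_μ‖₂ / w₀ + 2 (‖M_μ‖₂ / w₀) (η / w₀)`.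
Proof: transport every channel state radially, renormalise, and compare the quadratic forms of the
common profile `Ψ` (`∫ Ψ² ≤ w₀⁻¹`) by the Hilbert–Schmidt bound. [folklore] -/
theorem channelInf_le_channelInf_add (U : ℝ) (χ : D4Irrep) {w₀ η : ℝ} (hw₀ : 0 < w₀)
    (hw : ∀ θ, w₀ ≤ fermiPolarDOS μ θ) (hη0 : 0 ≤ η) (hη : ∀ θ, |fermiPolarDOS μ' θ - fermiPolarDOS μ θ| ≤ η)
    (hηw : 2 * η ≤ w₀) (hM : MemLp Mker[μ, U] 2 ((λθ).prod λθ)) (hM' : MemLp Mker[μ', U] 2 ((λθ).prod λθ)) :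
    channelInf (squareDispersion 1 0) μ' U χ ≤ channelInf (squareDispersion 1 0) μ U χ +
      (2 * Real.sqrt (∫ z, (Mker[μ', U] z - Mker[μ, U] z) ^ 2 ∂((λθ).prod λθ)) / w₀ +
        2 * (Real.sqrt (∫ z, Mker[μ, U] z ^ 2 ∂((λθ).prod λθ)) / w₀) * (η / w₀)) := by
  set D := Real.sqrt (∫ z, (Mker[μ', U] z - Mker[μ, U] z) ^ 2 ∂((λθ).prod λθ)) with hD
  set A := Real.sqrt (∫ z, Mker[μ, U] z ^ 2 ∂((λθ).prod λθ)) with hA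
  have hD0 : 0 ≤ D := Real.sqrt_nonneg _
  have hA0 : 0 ≤ A := Real.sqrt_nonneg _
  -- lower bound for the density at `μ'`
  have hw' : ∀ θ, w₀ / 2 ≤ fermiPolarDOS μ' θ := fun θ => by
    have := (abs_le.1 (hη θ)).1; have := hw θ; linarith
  have hw₀' : 0 < w₀ / 2 := by linarith
  -- the two `sInf`s are over non-empty, bounded-below sets
  have hne : ((pairingForm (squareDispersion 1 0) μ U) '' {ψ | IsChannelState (squareDispersion 1 0) μ χ ψ}).Nonempty :=
    (nonempty_isChannelState hμ₁ hμ₂ χ).image _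
  have hbdd' := pairingForm_bddBelow_image hμ₁' hμ₂' U χ hw₀' hw' hM'
  unfold channelInf
  rw [← sub_le_iff_le_add]
  refine le_csInf hne ?_
  rintro _ ⟨ψ, hψ, rfl⟩
  rw [sub_le_iff_le_add]
  -- the channel state `ψ` at level `μ` and its profile
  obtain ⟨hmem, hnorm, hch⟩ := hψ
  obtain ⟨hΨ, hΨle⟩ := memLp_profile hμ₁ hμ₂ hmem hw₀ hw
  rw [hnorm, mul_one] at hΨle
  have hΨ2 : 0 ≤ ∫ θ in Set.Ioc (-π) π, ψ (fermiPolar μ θ) ^ 2 := integral_nonneg fun θ => sq_nonneg _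
  -- the transported function `ψ̃` and its norm `N'`
  set ψt : Momentum → ℝ := fun k => if k = 0 then 0 else ψ (fermiPolar μ (Complex.arg ⟨k 0, k 1⟩)) with hψt
  have hTm : AEStronglyMeasurable ψt (fermiCurveMeasure (squareDispersion 1 0) μ') :=
    aestronglyMeasurable_transport hμ₁ hμ₂ hμ₁' hμ₂' hmem.1
  have hTmem : MemLp ψt 2 (fermiCurveMeasure (squareDispersion 1 0) μ') :=
    memLp_transport hμ₁ hμ₂ hμ₁' hμ₂' hmem hw₀ hw hη0 hη
  have hTch : InChannel χ ψt := inChannel_radialTransport hμ₁ hμ₂ hch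
  set N' := ∫ k, ψt k ^ 2 ∂fermiCurveMeasure (squareDispersion 1 0) μ' with hN'
  have hN'eq : N' = ∫ θ in Set.Ioc (-π) π, fermiPolarDOS μ' θ * ψ (fermiPolar μ θ) ^ 2 :=
    integral_sq_transport hμ₁ hμ₂ hμ₁' hμ₂' hmem.1
  have hone : (1 : ℝ) = ∫ θ in Set.Ioc (-π) π, fermiPolarDOS μ θ * ψ (fermiPolar μ θ) ^ 2 := by
    rw [← hnorm, integral_sq_fermiCurveMeasure hμ₁ hμ₂ hmem.1]
  -- `|N' - 1| ≤ η ∫ Ψ² ≤ η / w₀ ≤ 1/2`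
  have hsq : Integrable (fun k => ψ k ^ 2) (fermiCurveMeasure (squareDispersion 1 0) μ) :=
    (memLp_two_iff_integrable_sq hmem.1).1 hmem
  have hwΨ : Integrable (fun θ => fermiPolarDOS μ θ * ψ (fermiPolar μ θ) ^ 2) λθ :=
    (integrable_fermiCurveMeasure_iff hμ₁ hμ₂ (hmem.1.pow 2)).1 hsq
  have hΨsq : Integrable (fun θ => ψ (fermiPolar μ θ) ^ 2) λθ := (memLp_two_iff_integrable_sq hΨ.1).1 hΨ
  have hw'Ψ : Integrable (fun θ => fermiPolarDOS μ' θ * ψ (fermiPolar μ θ) ^ 2) λθ := by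
    have hT2 : Integrable (fun k => ψt k ^ 2) (fermiCurveMeasure (squareDispersion 1 0) μ') :=
      (memLp_two_iff_integrable_sq hTm).1 hTmem
    have hTm2 : AEStronglyMeasurable (fun k => ψt k ^ 2) (fermiCurveMeasure (squareDispersion 1 0) μ') :=
      hTm.pow 2
    have h := (integrable_fermiCurveMeasure_iff hμ₁' hμ₂' hTm2).1 hT2
    refine h.congr (Eventually.of_forall fun θ => ?_)
    simp only [hψt]
    rw [transport_fermiPolar hμ₁ hμ₂ hμ₁' hμ₂']
  have hN'sub : |N' - 1| ≤ η / w₀ := by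
    rw [hN'eq, hone, ← integral_sub hw'Ψ hwΨ]
    have hrw : (fun θ => fermiPolarDOS μ' θ * ψ (fermiPolar μ θ) ^ 2 - fermiPolarDOS μ θ * ψ (fermiPolar μ θ) ^ 2) =
        fun θ => (fermiPolarDOS μ' θ - fermiPolarDOS μ θ) * ψ (fermiPolar μ θ) ^ 2 := by
      funext θ; ring
    rw [hrw]
    calc |∫ θ in Set.Ioc (-π) π, (fermiPolarDOS μ' θ - fermiPolarDOS μ θ) * ψ (fermiPolar μ θ) ^ 2|
        ≤ ∫ θ in Set.Ioc (-π) π, |(fermiPolarDOS μ' θ - fermiPolarDOS μ θ) * ψ (fermiPolar μ θ) ^ 2| :=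
          abs_integral_le_integral_abs
      _ ≤ ∫ θ in Set.Ioc (-π) π, η * ψ (fermiPolar μ θ) ^ 2 := by
          refine integral_mono_of_nonneg (Eventually.of_forall fun θ => abs_nonneg _) (hΨsq.const_mul η)
            (Eventually.of_forall fun θ => ?_)
          dsimp only
          rw [abs_mul, abs_of_nonneg (sq_nonneg (ψ (fermiPolar μ θ)))]
          exact mul_le_mul_of_nonneg_right (hη θ) (sq_nonneg _)
      _ = η * ∫ θ in Set.Ioc (-π) π, ψ (fermiPolar μ θ) ^ 2 := integral_const_mul _ _
      _ ≤ η * w₀⁻¹ := mul_le_mul_of_nonneg_left hΨle hη0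
      _ = η / w₀ := by rw [div_eq_mul_inv]
  have hηw' : η / w₀ ≤ 1 / 2 := by
    rw [div_le_iff₀ hw₀]; linarith
  have hN'ge : 1 / 2 ≤ N' := by
    have := (abs_le.1 hN'sub).1; linarith
  have hN'pos : 0 < N' := by linarith
  -- the normalised transported state is a channel state at `μ'`
  have hstate : IsChannelState (squareDispersion 1 0) μ' χ (fun k => (Real.sqrt N')⁻¹ * ψt k) :=
    isChannelState_normalize hTmem hTch hN'pos
  -- its pairing form, in the angular picture
  have hPF' : pairingForm (squareDispersion 1 0) μ' U (fun k => (Real.sqrt N')⁻¹ * ψt k) =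
      N'⁻¹ * ∫ θ in Set.Ioc (-π) π, ψ (fermiPolar μ θ) * ∫ θ' in Set.Ioc (-π) π,
        (fermiPolarDOS μ' θ * kohnLuttingerKernel (squareDispersion 1 0) μ' U (fermiPolar μ' θ) (fermiPolar μ' θ') *
          fermiPolarDOS μ' θ') * ψ (fermiPolar μ θ') := by
    rw [pairingForm_const_mul, inv_pow, Real.sq_sqrt hN'pos.le]
    congr 1
    exact pairingForm_transport hμ₁ hμ₂ hμ₁' hμ₂' U hmem.1
  have hPF : pairingForm (squareDispersion 1 0) μ U ψ =
      ∫ θ in Set.Ioc (-π) π, ψ (fermiPolar μ θ) * ∫ θ' in Set.Ioc (-π) π,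
        (fermiPolarDOS μ θ * kohnLuttingerKernel (squareDispersion 1 0) μ U (fermiPolar μ θ) (fermiPolar μ θ') *
          fermiPolarDOS μ θ') * ψ (fermiPolar μ θ') :=
    pairingForm_eq_polar hμ₁ hμ₂ U hmem.1
  set T' := ∫ θ in Set.Ioc (-π) π, ψ (fermiPolar μ θ) * ∫ θ' in Set.Ioc (-π) π,
    (fermiPolarDOS μ' θ * kohnLuttingerKernel (squareDispersion 1 0) μ' U (fermiPolar μ' θ) (fermiPolar μ' θ') *
          fermiPolarDOS μ' θ') * ψ (fermiPolar μ θ') with hT'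
  set T := ∫ θ in Set.Ioc (-π) π, ψ (fermiPolar μ θ) * ∫ θ' in Set.Ioc (-π) π,
    (fermiPolarDOS μ θ * kohnLuttingerKernel (squareDispersion 1 0) μ U (fermiPolar μ θ) (fermiPolar μ θ') *
          fermiPolarDOS μ θ') * ψ (fermiPolar μ θ') with hT
  -- Hilbert–Schmidt control of `T' - T` and of `T`
  have hdiff : |T' - T| ≤ D / w₀ := by
    have h := abs_iterated_sub_iterated_le hΨ hM' hM
    refine h.trans ?_
    rw [div_eq_mul_inv, mul_comm D]
    exact mul_le_mul_of_nonneg_right hΨle hD0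
  have habsT : |T| ≤ A / w₀ := by
    have h := abs_integral_mul_integral_mul_le hΨ hM
    refine h.trans ?_
    rw [div_eq_mul_inv, mul_comm A]
    exact mul_le_mul_of_nonneg_right hΨle hA0
  -- `sInf ≤ PF'(ψ̂) = T'/N' ≤ T + 2D/w₀ + 2(A/w₀)(η/w₀)`
  have hle : sInf ((pairingForm (squareDispersion 1 0) μ' U) '' {ψ | IsChannelState (squareDispersion 1 0) μ' χ ψ}) ≤
      N'⁻¹ * T' := by
    rw [← hPF']
    exact csInf_le hbdd' ⟨_, hstate, rfl⟩
  refine hle.trans ?_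
  rw [hPF]
  -- elementary arithmetic with `N' ∈ [1/2, 3/2]`, `|T' - T| ≤ D/w₀`, `|T| ≤ A/w₀`, `|N' - 1| ≤ η/w₀`
  have hkey : N'⁻¹ * T' - T = N'⁻¹ * (T' - T) + N'⁻¹ * (T * (1 - N')) := by
    field_simp
    ring
  have h1 : N'⁻¹ * (T' - T) ≤ 2 * D / w₀ := by
    have hinv : N'⁻¹ ≤ 2 := by rw [inv_le_comm₀ hN'pos (by norm_num)]; linarith
    have hinv0 : 0 ≤ N'⁻¹ := inv_nonneg.2 hN'pos.le
    calc N'⁻¹ * (T' - T) ≤ N'⁻¹ * |T' - T| := mul_le_mul_of_nonneg_left (le_abs_self _) hinv0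
      _ ≤ 2 * (D / w₀) := mul_le_mul hinv hdiff (abs_nonneg _) (by norm_num)
      _ = 2 * D / w₀ := by ring
  have h2 : N'⁻¹ * (T * (1 - N')) ≤ 2 * (A / w₀) * (η / w₀) := by
    have hinv : N'⁻¹ ≤ 2 := by rw [inv_le_comm₀ hN'pos (by norm_num)]; linarith
    have hinv0 : 0 ≤ N'⁻¹ := inv_nonneg.2 hN'pos.le
    have hprod : |T * (1 - N')| ≤ A / w₀ * (η / w₀) := by
      rw [abs_mul]
      refine mul_le_mul habsT ?_ (abs_nonneg _) (div_nonneg hA0 hw₀.le)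
      rw [abs_sub_comm]; exact hN'sub
    calc N'⁻¹ * (T * (1 - N')) ≤ N'⁻¹ * |T * (1 - N')| := mul_le_mul_of_nonneg_left (le_abs_self _) hinv0
      _ ≤ 2 * (A / w₀ * (η / w₀)) := mul_le_mul hinv hprod (abs_nonneg _) (by norm_num)
      _ = 2 * (A / w₀) * (η / w₀) := by ring
  have : N'⁻¹ * T' - T ≤ 2 * D / w₀ + 2 * (A / w₀) * (η / w₀) := by rw [hkey]; linarith
  linarith

end Transport

end Summit.HubbardSuperconductivity.HubbardSuperconductivity.Theorems

end
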